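import Literature.Algebra.Homology.DiscreteRepCoinduced
import Literature.Algebra.Homology.DiscreteRepContinuous
import Literature.Algebra.Homology.ExtOfAcyclicResolution
import Literature.NumberTheory.GaloisRepresentations.GaloisCohomology
import Mathlib.RepresentationTheory.Homological.ContCohomology.Basic
import Mathlib.Algebra.Category.ModuleCat.Topology.Homology
import Mathlib.Algebra.Homology.ShortComplex.ModuleCat
import HarnessLib

/-!
# Mathlib's standard continuous-cochain complex is an acyclic resolution in `C_Γ`;
# the comparison `Extⁿ_{C_Γ}(k, M) ≅ Hⁿ_cont(Γ, M)` for a compact group and a discrete module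

Topic `Algebra/Homology`; namespace `Literature.Algebra.Homology.DiscreteRep`.  Definitions with bodies
and theorems; no named fact, no `sorry`.  Sequel of `DiscreteRepCategory` (the abelian category
`C_Γ = DiscreteRepCat k Γ` of `k`-linear representations of a topological group `Γ` with open
stabilisers), `DiscreteRepEnoughInjectives` (`Ext` in `C_Γ`), `DiscreteRepInvariants` (`triv`,
`ext₀TrivEquiv : Ext⁰(k, M) ≃+ M^Γ`), `DiscreteRepCoinduced` (co-induced modules are `Ext(k,–)`-acyclic
over a compact `Γ`) and `ExtOfAcyclicResolution` (`Extⁿ(X, M) ≅ Hⁿ(Ext⁰(X, I•))` for an exact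
acyclic augmented complex).  Written for Route A of the Poitou–Tate programme of crux
`stmt-BirchSwinnertonDyer-19295` (cell `bsd-schneider-ideate`, seat door-c4 gen 13), step G5′-ii:
**the comparison of `Ext` in Harari's category `C_G` with continuous-cochain cohomology**
(Harari, *Galois Cohomology and Class Field Theory*, §4.3 and Remark 4.24: the `H^q(G, ·)` of
Definition 4.17 — continuous = locally constant cochains — are the derived functors of `A ↦ A^G` on
`C_G`), for Mathlib's `continuousCohomology` (homology of the complex of homogeneous continuous
cochains `TopRep.homogeneousCochains`, i.e. the invariants of the standard complex
`M → C(Γ, M) → C(Γ, C(Γ, M)) → ⋯`, `TopRep.resolution`) and hence for the tree's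
`galoisCohomology ρ n`.

The proof is the acyclic-resolution argument (Serre, *Galois Cohomology* I §2.5; Harari Rem. 4.24
uses injectives instead): for `Γ` COMPACT and `M` discrete with open stabilisers,
(1) every term `C(Γ, C(Γ, … M))` of Mathlib's standard complex is again discrete with open
stabilisers (a continuous map from a compact space to a discrete space takes finitely many values
on clopen fibres; the compact-open topology on `C(Γ, V)` is discrete);
(2) the twisted action `(g • f)(x) = g · f(g⁻¹ x)` of `TopRep.coind₁` is isomorphic to the co-induced
module `LocallyConstant Γ M` of `DiscreteRepCoinduced` by `f ↦ (x ↦ x⁻¹ · f(x))`, so every term is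
`Ext(k, –)`-acyclic; (3) the augmented complex is exact, by the contracting homotopy
"evaluate at `1`": `dⁿ(f(1)) = f − (dⁿ⁺¹ f)(1)`; (4) `Ext⁰(triv k, ·)` of the complex is Mathlib's
`homogeneousCochains` viewed in `AddCommGrpCat` (through `forget₂ : TopModuleCat k ⥤ ModuleCat k ⥤ Ab`,
which preserves homology); (5) `ExtOfAcyclicResolution` concludes.

## What is here
* `forgetTop : TopRep k Γ ⥤ Rep k Γ`; `discreteTopology_continuousMap` (compact source, discrete
  target); `untwist` / `twist` / `untwistIso : forgetTop (coind₁ X) ≅ coindRep k Γ X`;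
  `isDiscrete_coind₁`; `discreteTopology_resolutionX`, `isDiscrete_resolutionX`.
* `stdObj`, `stdComplex X` (Mathlib's `resolution' X` as a cochain complex of `C_Γ`), its
  augmentation `stdη`, `d_hom_apply_one` (the homotopy identity), exactness `stdComplex_exactAt_succ`,
  `exact_stdη`, `mono_stdη`, acyclicity `ext_triv_stdObj_eq_zero`.
* `extComplexIso` (`extComplex (triv k) (stdComplex X) ≅ homogeneousCochains X` in `Ab`) and the
  main results **`extTrivAddEquivContinuousCohomology :
  Ext (triv k) (stdBase X) n ≃+ continuousCohomology n X`** and, for a discrete Galois module over a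
  field `K` (universe `0`) with compact `Γ_K`,
  **`extTrivAddEquivGaloisCohomology : Ext (triv ℤ) (ofDiscreteGaloisModule ρ) n ≃+ galoisCohomology ρ n`**.

Not here: naturality in `M`; compatibility with cup products / connecting maps; non-compact `Γ`.

## References
* D. Harari, *Galois Cohomology and Class Field Theory* (2020), §4.3, Def. 4.17, Cor. 4.21, Rem. 4.24. [Harari2020]
* J.-P. Serre, *Galois Cohomology*, Springer (1997), I §2.2, §2.5. [SerreGaloisCohomology1997]
-/

noncomputable section

universe u

namespace Literature.Algebra.Homology

namespace DiscreteRep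

open CategoryTheory CategoryTheory.Limits CategoryTheory.Abelian Filter TopRep ContRepresentation
open scoped _root_.Topology

variable {k Γ : Type u} [CommRing k] [TopologicalSpace k] [Group Γ]

/-! ## §1 Forgetting the topology: `TopRep k Γ ⥤ Rep k Γ` -/

variable (k Γ) in
/-- The forgetful functor from topological representations to representations.
[cite: Harari2020, §4.2] -/
abbrev forgetTop : TopRep.{u} k Γ ⥤ Rep.{u} k Γ where
  obj X := Rep.of X.ρ.toRepresentation
  map f := Rep.ofHom f.hom.toIntertwiningMap
  map_id _ := rfl
  map_comp _ _ := rfl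

/-- On morphisms, elementwise. [cite: Harari2020, §4.2] -/
@[simp]
theorem forgetTop_map_apply {X Y : TopRep.{u} k Γ} (f : X ⟶ Y) (x : X.V) :
    ((forgetTop k Γ).map f).hom x = f.hom x := rfl

/-- `ρ` of the underlying representation, elementwise. [cite: Harari2020, §4.2] -/
@[simp]
theorem forgetTop_obj_ρ_apply (X : TopRep.{u} k Γ) (g : Γ) (x : X.V) :
    ((forgetTop k Γ).obj X).ρ g x = X.ρ g x := rfl

/-- `forgetTop` is additive. [cite: Harari2020, §4.2] -/
instance : (forgetTop k Γ).Additive where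
  map_add := rfl

/-- The invariants of the underlying representation are the invariants. [cite: Harari2020, §4.3] -/
theorem invariants_forgetTop (T : TopRep.{u} k Γ) :
    ((forgetTop k Γ).obj T).ρ.invariants = T.ρ.invariants :=
  Submodule.ext fun _ => Iff.rfl

variable [TopologicalSpace Γ]

/-! ## §2 Generalities: `C(Γ, V)` for `Γ` compact and `V` discrete; `Ext⁰` bookkeeping; exactness transfer -/

omit [Group Γ] in
/-- A continuous map from a COMPACT space to a DISCRETE space is pinned down by the open condition
"maps each (compact) fibre of `f` to the corresponding value"; hence the compact-open topology on
`C(Γ, V)` is discrete. [cite: SerreGaloisCohomology1997, I §2.5] -/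
theorem discreteTopology_continuousMap [CompactSpace Γ] (V : Type u) [TopologicalSpace V]
    [DiscreteTopology V] : DiscreteTopology C(Γ, V) := by
  rw [discreteTopology_iff_isOpen_singleton]
  intro f
  have hf : IsLocallyConstant (f : Γ → V) := (IsLocallyConstant.iff_continuous f).2 f.continuous
  have h : ({f} : Set C(Γ, V)) =
      ⋂ y ∈ Set.range f, {g : C(Γ, V) | Set.MapsTo g (f ⁻¹' {y}) {y}} := by
    ext g
    simp only [Set.mem_singleton_iff, Set.mem_iInter, Set.mem_setOf_eq]
    constructor
    · rintro rfl y _ x hx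
      exact hx
    · intro hg
      ext x
      exact hg (f x) ⟨x, rfl⟩ rfl
  rw [h]
  exact hf.range_finite.isOpen_biInter fun y _ =>
    ContinuousMap.isOpen_setOf_mapsTo (hf.isClosed_fiber y).isCompact (isOpen_discrete _)

variable [IsTopologicalGroup Γ]

omit [TopologicalSpace k] in
/-- `ext₀TrivEquiv` on underlying vectors: the class `x : Ext⁰(k, M)` goes to `x(1)`.
[cite: Harari2020, §4.3] -/
theorem ext₀TrivEquiv_apply_coe (M : DiscreteRepCat k Γ) (x : Ext (triv (Γ := Γ) k) M 0) :
    ((ext₀TrivEquiv M x : M.obj.ρ.invariants) : M.obj.V) = (Ext.addEquiv₀ x).hom.hom (1 : k) := rfl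

omit [TopologicalSpace k] in
/-- `Ext⁰`-functoriality read through `addEquiv₀`: `addEquiv₀ (x ∘ f) = addEquiv₀ x ≫ f`.
[cite: Harari2020, §4.3] -/
theorem addEquiv₀_comp_mk₀ {L M N : DiscreteRepCat k Γ} (x : Ext L M 0) (f : M ⟶ N) :
    Ext.addEquiv₀ (x.comp (Ext.mk₀ f) (add_zero 0)) = Ext.addEquiv₀ x ≫ f := by
  apply Ext.addEquiv₀.symm.injective
  rw [AddEquiv.symm_apply_apply, Ext.addEquiv₀_symm_apply, ← Ext.mk₀_comp_mk₀,
    Ext.mk₀_addEquiv₀_apply]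

omit [TopologicalSpace k] in
/-- Exactness in `C_Γ` from an elementwise lifting property (transfer through the faithful exact
functors `C_Γ ⥤ Rep k Γ ⥤ Mod_k`). [cite: Harari2020, §4.2] -/
theorem shortComplex_exact_of_forall {A B C' : DiscreteRepCat k Γ} (f : A ⟶ B) (g : B ⟶ C')
    (w : f ≫ g = 0) (h : ∀ b : B.obj.V, g.hom.hom b = 0 → ∃ a : A.obj.V, f.hom.hom a = b) :
    (ShortComplex.mk f g w).Exact := by
  haveI : (ι k Γ).PreservesHomology :=
    ⟨fun _ _ f => (isDiscrete k Γ).preservesKernels_ι f,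
      fun _ _ f => (isDiscrete k Γ).preservesCokernels_ι f⟩
  rw [← ShortComplex.exact_map_iff_of_faithful _ (ι k Γ),
    ← ShortComplex.exact_map_iff_of_faithful _ (forget₂ (Rep.{u} k Γ) (ModuleCat.{u} k)),
    ShortComplex.moduleCat_exact_iff]
  intro x₂ hx₂
  obtain ⟨a, ha⟩ := h x₂ hx₂
  exact ⟨a, ha⟩

/-- **The homotopy identity** `dⁿ(f(1)) = f − (dⁿ⁺¹ f)(1)` for `f ∈ C(Γ, Jⁿ)` in Mathlib's standard
complex (inductive differential `dⁿ⁺¹ f = const f − dⁿ ∘ f`). [cite: SerreGaloisCohomology1997, I §2.2] -/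
theorem d_hom_apply_one (X : TopRep.{u} k Γ) (n : ℕ) (f : C(Γ, (resolutionX X n).V)) :
    (TopRep.d X n).hom (f 1) =
      f - ((TopRep.d X (n + 1)).hom f : C(Γ, C(Γ, (resolutionX X n).V))) 1 := by
  have h : ((TopRep.d X (n + 1)).hom f : C(Γ, C(Γ, (resolutionX X n).V))) 1 =
      f - (TopRep.d X n).hom (f 1) := rfl
  rw [h, sub_sub_cancel]

/-- Hence a cocycle of the standard complex is the coboundary of its value at `1`.
[cite: SerreGaloisCohomology1997, I §2.2] -/
theorem d_hom_apply_one_of_d_eq_zero (X : TopRep.{u} k Γ) (n : ℕ) (f : C(Γ, (resolutionX X n).V))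
    (hf : (TopRep.d X (n + 1)).hom f = 0) : (TopRep.d X n).hom (f 1) = f := by
  rw [d_hom_apply_one, hf]
  exact sub_zero f

/-- The augmentation `X → C(Γ, X)` (constant maps) is injective. [cite: SerreGaloisCohomology1997, I §2.2] -/
theorem d_zero_injective (X : TopRep.{u} k Γ) : Function.Injective (TopRep.d X 0).hom :=
  fun _ _ h => congrArg (fun f : C(Γ, X.V) => f 1) h

/-! ## §3 Untwisting Mathlib's `coind₁`: `C(Γ, X)` with `(g•f)(x) = g·f(g⁻¹x)` is `CoInd X` -/

section Untwist

variable (X : TopRep.{u} k Γ)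

/-- For `X` with open stabilisers, `x ↦ ρ(x) (h x)` is continuous for every locally constant `h`.
[cite: SerreGaloisCohomology1997, I §2.5] -/
theorem continuous_twist (hX : IsDiscrete ((forgetTop k Γ).obj X)) (h : LocallyConstant Γ X.V) :
    Continuous (fun x : Γ => X.ρ x (h x)) := by
  refine ((IsLocallyConstant.iff_eventually_eq _).2 fun x => ?_).continuous
  have h1 : ∀ᶠ y in 𝓝 x, h y = h x := h.isLocallyConstant.eventually_eq x
  have h2 : (fun y : Γ => x⁻¹ * y) ⁻¹' (stabilizer ((forgetTop k Γ).obj X) (h x) : Set Γ) ∈ 𝓝 x :=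
    ((hX (h x)).preimage (continuous_const.mul continuous_id)).mem_nhds (by simp)
  filter_upwards [h1, h2] with y hy hy'
  have hy'' : X.ρ (x⁻¹ * y) (h x) = h x := (mem_stabilizer_iff _ _ _).1 hy'
  have hxy : X.ρ y = X.ρ x * X.ρ (x⁻¹ * y) := by rw [← map_mul X.ρ, mul_inv_cancel_left]
  rw [hy, hxy]
  exact congrArg (X.ρ x) hy''

/-- **Twisting map** `LocallyConstant Γ X → C(Γ, X)`, `h ↦ (x ↦ ρ(x) (h x))` (inverse of `untwist`).
[cite: SerreGaloisCohomology1997, I §2.5] -/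
def twist (hX : IsDiscrete ((forgetTop k Γ).obj X)) : coindRep k Γ X.V ⟶ (forgetTop k Γ).obj X.coind₁ :=
  Rep.ofHom
    ⟨{ toFun := fun h => ⟨fun x => X.ρ x (h x), continuous_twist X hX h⟩
       map_add' := fun f g => ContinuousMap.ext fun x => by simp
       map_smul' := fun c f => ContinuousMap.ext fun x => by simp },
     fun g => LinearMap.ext fun (h : LocallyConstant Γ X.V) => ContinuousMap.ext fun x => by
       change X.ρ x (h (g⁻¹ * x)) = X.ρ g (X.ρ (g⁻¹ * x) (h (g⁻¹ * x)))
       have : X.ρ x = X.ρ g * X.ρ (g⁻¹ * x) := by rw [← map_mul X.ρ, mul_inv_cancel_left]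
       rw [this]
       rfl⟩

/-- Formula for `twist`. [cite: SerreGaloisCohomology1997, I §2.5] -/
@[simp]
theorem twist_apply_apply (hX : IsDiscrete ((forgetTop k Γ).obj X)) (h : LocallyConstant Γ X.V) (x : Γ) :
    ((twist X hX).hom h : C(Γ, X.V)) x = X.ρ x (h x) := rfl

variable [DiscreteTopology X.V]

/-- For `X` discrete with open stabilisers, `x ↦ ρ(x⁻¹) (f x)` is locally constant for every
`f ∈ C(Γ, X)`. [cite: SerreGaloisCohomology1997, I §2.5] -/
theorem isLocallyConstant_untwist (hX : IsDiscrete ((forgetTop k Γ).obj X)) (f : C(Γ, X.V)) :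
    IsLocallyConstant (fun x : Γ => X.ρ x⁻¹ (f x)) := by
  refine (IsLocallyConstant.iff_eventually_eq _).2 fun x => ?_
  have h1 := ((IsLocallyConstant.iff_continuous f).2 f.continuous).eventually_eq x
  have h2 : ∀ᶠ y in 𝓝 x, X.ρ y⁻¹ (f x) = X.ρ x⁻¹ (f x) :=
    (isLocallyConstant_ρ_inv_apply (mk ((forgetTop k Γ).obj X) hX) (f x)).eventually_eq x
  filter_upwards [h1, h2] with y hy hy'
  rw [hy, hy']

/-- **Untwisting map** `C(Γ, X) → LocallyConstant Γ X`, `f ↦ (x ↦ ρ(x⁻¹) (f x))`, from Mathlib's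
`coind₁ X` (action `(g • f)(x) = ρ(g) f(g⁻¹ x)`) to the co-induced module (action
`(g • h)(x) = h(g⁻¹ x)`); it is `k`-linear and `Γ`-equivariant. [cite: SerreGaloisCohomology1997, I §2.5] -/
def untwist (hX : IsDiscrete ((forgetTop k Γ).obj X)) :
    ((forgetTop k Γ).obj X.coind₁) ⟶ coindRep k Γ X.V :=
  Rep.ofHom
    ⟨{ toFun := fun f => ⟨fun x => X.ρ x⁻¹ (f x), isLocallyConstant_untwist X hX f⟩
       map_add' := fun f g => LocallyConstant.ext fun x => by simp
       map_smul' := fun c f => LocallyConstant.ext fun x => by simp },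
     fun g => LinearMap.ext fun (f : C(Γ, X.V)) => LocallyConstant.ext fun x => by
       change X.ρ x⁻¹ ((X.ρ.coind₁ g f) x) = X.ρ (g⁻¹ * x)⁻¹ (f (g⁻¹ * x))
       rw [coind₁_apply_apply, mul_inv_rev, inv_inv, map_mul X.ρ]
       rfl⟩

/-- Formula for `untwist`. [cite: SerreGaloisCohomology1997, I §2.5] -/
@[simp]
theorem untwist_apply_apply (hX : IsDiscrete ((forgetTop k Γ).obj X)) (f : C(Γ, X.V)) (x : Γ) :
    ((untwist X hX).hom f : LocallyConstant Γ X.V) x = X.ρ x⁻¹ (f x) := rfl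

/-- **`coind₁ X ≅ CoInd X` in `Rep k Γ`** (untwisting). [cite: SerreGaloisCohomology1997, I §2.5] -/
def untwistIso (hX : IsDiscrete ((forgetTop k Γ).obj X)) :
    (forgetTop k Γ).obj X.coind₁ ≅ coindRep k Γ X.V where
  hom := untwist X hX
  inv := twist X hX
  hom_inv_id := Rep.hom_ext (DFunLike.ext _ _ fun (f : C(Γ, X.V)) => ContinuousMap.ext fun x => by
    change X.ρ x (X.ρ x⁻¹ (f x)) = f x
    have : X.ρ x * X.ρ x⁻¹ = 1 := by rw [← map_mul X.ρ, mul_inv_cancel, map_one]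
    exact congrArg (fun T : X.V →L[k] X.V => T (f x)) this)
  inv_hom_id := Rep.hom_ext (DFunLike.ext _ _ fun (h : LocallyConstant Γ X.V) =>
    LocallyConstant.ext fun x => by
      change X.ρ x⁻¹ (X.ρ x (h x)) = h x
      have : X.ρ x⁻¹ * X.ρ x = 1 := by rw [← map_mul X.ρ, inv_mul_cancel, map_one]
      exact congrArg (fun T : X.V →L[k] X.V => T (h x)) this)

/-- **Mathlib's `coind₁ X` has open stabilisers** for `Γ` compact and `X` discrete with open
stabilisers (transport along `untwistIso` from `isDiscrete_coindRep`). [cite: SerreGaloisCohomology1997, I §2.5] -/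
theorem isDiscrete_coind₁ [CompactSpace Γ] (hX : IsDiscrete ((forgetTop k Γ).obj X)) :
    IsDiscrete ((forgetTop k Γ).obj X.coind₁) :=
  IsDiscrete.of_injective (untwistIso X hX).hom
    ((Rep.mono_iff_injective (untwistIso X hX).hom).1 inferInstance) (isDiscrete_coindRep X.V)

end Untwist

/-! ## §4 The standard complex in `C_Γ`: objects, differentials, augmentation -/

section Standard

variable [CompactSpace Γ] (X : TopRep.{u} k Γ) [DiscreteTopology X.V]
  (hX : IsDiscrete ((forgetTop k Γ).obj X))

omit [IsTopologicalGroup Γ] in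
/-- Every term `C(Γ, C(Γ, … X))` of the standard complex is topologically discrete.
[cite: SerreGaloisCohomology1997, I §2.5] -/
theorem discreteTopology_resolutionX [IsTopologicalGroup Γ] :
    ∀ n : ℕ, DiscreteTopology (resolutionX X n).V
  | 0 => inferInstanceAs (DiscreteTopology X.V)
  | n + 1 => by
    haveI := discreteTopology_resolutionX n
    exact discreteTopology_continuousMap (Γ := Γ) (resolutionX X n).V

/-- Every term of the standard complex has open stabilisers. [cite: SerreGaloisCohomology1997, I §2.5] -/
theorem isDiscrete_resolutionX (hX : IsDiscrete ((forgetTop k Γ).obj X)) :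
    ∀ n : ℕ, IsDiscrete ((forgetTop k Γ).obj (resolutionX X n))
  | 0 => hX
  | n + 1 => by
    haveI := discreteTopology_resolutionX X n
    exact isDiscrete_coind₁ (resolutionX X n) (isDiscrete_resolutionX hX n)

/-- The `n`-th term of the standard complex as an object of `C_Γ` (`n = 0`: `X` itself).
[cite: Harari2020, §4.3] -/
def stdObj (n : ℕ) : DiscreteRepCat k Γ :=
  mk ((forgetTop k Γ).obj (resolutionX X n)) (isDiscrete_resolutionX X hX n)

/-- `X` as an object of `C_Γ` (= `stdObj X hX 0`). [cite: Harari2020, §4.3] -/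
abbrev stdBase : DiscreteRepCat k Γ := stdObj X hX 0

/-- **Mathlib's standard complex `C(Γ, X) → C(Γ, C(Γ, X)) → ⋯` (`TopRep.resolution' X`) as a
cochain complex in `C_Γ`.** [cite: Harari2020, §4.3] -/
def stdComplex : CochainComplex (DiscreteRepCat k Γ) ℕ :=
  CochainComplex.of (fun n => stdObj X hX (n + 1))
    (fun n => ObjectProperty.homMk (X := stdObj X hX (n + 1)) (Y := stdObj X hX (n + 1 + 1))
      ((forgetTop k Γ).map (TopRep.d X (n + 1))))
    (fun n => ObjectProperty.hom_ext _ (by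
      change (forgetTop k Γ).map (TopRep.d X (n + 1)) ≫ (forgetTop k Γ).map (TopRep.d X (n + 1 + 1)) = 0
      rw [← Functor.map_comp, TopRep.d_comp_d, Functor.map_zero]))

/-- The differential of `stdComplex`. [cite: Harari2020, §4.3] -/
theorem stdComplex_d (n : ℕ) :
    (stdComplex X hX).d n (n + 1) =
      ObjectProperty.homMk (X := stdObj X hX (n + 1)) (Y := stdObj X hX (n + 1 + 1))
        ((forgetTop k Γ).map (TopRep.d X (n + 1))) := by
  dsimp only [stdComplex]
  exact CochainComplex.of_d _ _ n

/-- The differential of `stdComplex`, elementwise. [cite: Harari2020, §4.3] -/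
theorem stdComplex_d_apply (n : ℕ) (f : (resolutionX X (n + 1)).V) :
    ((stdComplex X hX).d n (n + 1)).hom.hom f = (TopRep.d X (n + 1)).hom f := by
  rw [stdComplex_d]
  rfl

/-- The augmentation `X → C(Γ, X)` (constant maps) as a morphism of `C_Γ`. [cite: Harari2020, §4.3] -/
def stdη : stdBase X hX ⟶ (stdComplex X hX).X 0 :=
  ObjectProperty.homMk (X := stdObj X hX 0) (Y := stdObj X hX 1) ((forgetTop k Γ).map (TopRep.d X 0))

/-- `η ≫ d⁰ = 0`. [cite: Harari2020, §4.3] -/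
theorem stdη_d : stdη X hX ≫ (stdComplex X hX).d 0 1 = 0 := by
  rw [stdComplex_d]
  apply ObjectProperty.hom_ext
  change (forgetTop k Γ).map (TopRep.d X 0) ≫ (forgetTop k Γ).map (TopRep.d X (0 + 1)) = 0
  rw [← Functor.map_comp, TopRep.d_comp_d, Functor.map_zero]

/-! ## §5 Exactness and acyclicity; the abstract comparison -/

/-- **The standard complex is exact in every positive degree.** [cite: SerreGaloisCohomology1997, I §2.2] -/
theorem stdComplex_exactAt_succ (n : ℕ) : (stdComplex X hX).ExactAt (n + 1) := by
  rw [(stdComplex X hX).exactAt_iff' n (n + 1) (n + 1 + 1) (CochainComplex.prev_nat_succ n)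
    (CochainComplex.next ℕ (n + 1))]
  refine shortComplex_exact_of_forall _ _ _ fun (b : C(Γ, (resolutionX X (n + 1)).V)) hb => ?_
  refine ⟨b 1, ?_⟩
  have hb' : (TopRep.d X (n + 1 + 1)).hom b = 0 := by rw [← stdComplex_d_apply X hX (n + 1) b]; exact hb
  rw [stdComplex_d_apply]
  exact d_hom_apply_one_of_d_eq_zero X (n + 1) b hb'

/-- **The augmented standard complex is exact at `C(Γ, X)`.** [cite: SerreGaloisCohomology1997, I §2.2] -/
theorem exact_stdη : (ShortComplex.mk (stdη X hX) ((stdComplex X hX).d 0 1) (stdη_d X hX)).Exact := by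
  refine shortComplex_exact_of_forall _ _ _ fun (b : C(Γ, X.V)) hb => ?_
  have hb' : (TopRep.d X (0 + 1)).hom b = 0 := by rw [← stdComplex_d_apply X hX 0 b]; exact hb
  exact ⟨b 1, d_hom_apply_one_of_d_eq_zero X 0 b hb'⟩

/-- The augmentation is a monomorphism of `C_Γ`. [cite: SerreGaloisCohomology1997, I §2.2] -/
instance mono_stdη : Mono (stdη X hX) := by
  apply (ι k Γ).mono_of_mono_map
  rw [Rep.mono_iff_injective]
  exact d_zero_injective X

/-- **Each term of the standard complex is `CoInd` of the previous one** (in `C_Γ`).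
[cite: SerreGaloisCohomology1997, I §2.5] -/
def stdObjSuccIso (n : ℕ) :
    haveI := discreteTopology_resolutionX X n
    stdObj X hX (n + 1) ≅ coind k Γ (resolutionX X n).V :=
  haveI := discreteTopology_resolutionX X n
  (isDiscrete k Γ).isoMk (untwistIso (resolutionX X n) (isDiscrete_resolutionX X hX n))

/-- **The terms of the standard complex are `Ext(k, –)`-acyclic.** [cite: SerreGaloisCohomology1997, I §2.5] -/
theorem ext_triv_stdComplex_X_eq_zero (n q : ℕ)
    (e : Ext (triv (Γ := Γ) k) ((stdComplex X hX).X n) (q + 1)) : e = 0 :=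
  haveI := discreteTopology_resolutionX X n
  ext_triv_eq_zero_of_iso_coind (stdObjSuccIso X hX n) q e

/-- **`Extⁿ_{C_Γ}(k, X) ≃+ Hⁿ(Ext⁰(k, standard complex))`** (`ExtOfAcyclicResolution`).
[cite: Harari2020, §4.3, Remark 4.24] -/
def extTrivAddEquivExtComplexHomology (n : ℕ) :
    Ext (triv (Γ := Γ) k) (stdBase X hX) n ≃+
      ((AcyclicResolution.extComplex (triv (Γ := Γ) k) (stdComplex X hX)).homology n :
        AddCommGrpCat.{u}) :=
  match n with
  | 0 => AcyclicResolution.extAddEquivHomologyZero (triv k) (stdComplex X hX) (stdη X hX)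
      (stdη_d X hX) (exact_stdη X hX)
  | n + 1 => AcyclicResolution.extAddEquivHomologySucc (triv k) (stdComplex X hX) (stdη X hX)
      (stdη_d X hX) (exact_stdη X hX) (stdComplex_exactAt_succ X hX)
      (ext_triv_stdComplex_X_eq_zero X hX) n

/-! ## §6 `Ext⁰(k, standard complex) =` Mathlib's `homogeneousCochains`, and the comparison -/

variable (k) in
/-- The forgetful functor `TopModuleCat k ⥤ AddCommGrpCat` (through `ModuleCat k`). [cite: Harari2020, §4.3] -/
abbrev forgetAb : TopModuleCat.{u} k ⥤ AddCommGrpCat.{u} :=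
  forget₂ (TopModuleCat.{u} k) (ModuleCat.{u} k) ⋙ forget₂ (ModuleCat.{u} k) AddCommGrpCat.{u}

/-- Mathlib's homogeneous cochains of `X`, as a cochain complex of abelian groups.
[cite: Harari2020, §4.3, Definition 4.17] -/
abbrev cochainsAb : CochainComplex AddCommGrpCat.{u} ℕ :=
  ((forgetAb k).mapHomologicalComplex (ComplexShape.up ℕ)).obj (homogeneousCochains X)

/-- The `n`-th component of the comparison: `Ext⁰(k, C(Γ,…)) ≃+ C(Γ,…)^Γ` (`x ↦ x(1)`).
[cite: Harari2020, §4.3] -/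
def extComplexXAddEquiv (n : ℕ) :
    Ext (triv (Γ := Γ) k) ((stdComplex X hX).X n) 0 ≃+ (resolutionX X (n + 1)).ρ.invariants :=
  (ext₀TrivEquiv ((stdComplex X hX).X n)).trans
    (LinearEquiv.ofEq _ _ (invariants_forgetTop (resolutionX X (n + 1)))).toAddEquiv

/-- Formula: the underlying vector of `extComplexXAddEquiv n x` is `x(1)`. [cite: Harari2020, §4.3] -/
theorem extComplexXAddEquiv_apply_coe (n : ℕ) (x : Ext (triv (Γ := Γ) k) ((stdComplex X hX).X n) 0) :
    ((extComplexXAddEquiv X hX n x : (resolutionX X (n + 1)).ρ.invariants) :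
        (resolutionX X (n + 1)).V) =
      (Ext.addEquiv₀ x).hom.hom (1 : k) := rfl

/-- **`Ext⁰(k, standard complex) ≅ homogeneousCochains X`** as cochain complexes of abelian groups.
[cite: Harari2020, §4.3, Definition 4.17 and Remark 4.24] -/
def extComplexIso :
    AcyclicResolution.extComplex (triv (Γ := Γ) k) (stdComplex X hX) ≅ cochainsAb X :=
  HomologicalComplex.Hom.isoOfComponents
    (fun n => AddEquiv.toAddCommGrpIso (extComplexXAddEquiv X hX n))
    (fun i j hij => by
      obtain rfl : i + 1 = j := hij
      ext x
      apply Subtype.ext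
      change Subtype.val (p := fun v => v ∈ (resolutionX X (i + 1 + 1)).ρ.invariants)
          (((homogeneousCochains X).d i (i + 1)).hom (extComplexXAddEquiv X hX i x)) =
        (Ext.addEquiv₀ (x.comp (Ext.mk₀ ((stdComplex X hX).d i (i + 1))) (add_zero 0))).hom.hom
          (1 : k)
      rw [homogeneousCochains.d_apply, extComplexXAddEquiv_apply_coe, addEquiv₀_comp_mk₀,
        stdComplex_d]
      rfl)

/-- **`Hⁿ(Ext⁰(k, standard complex)) ≅ Hⁿ_cont(Γ, X)`** (as abelian groups): transport homology
along `extComplexIso` and use that `TopModuleCat k ⥤ AddCommGrpCat` preserves homology.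
[cite: Harari2020, §4.3, Remark 4.24] -/
def extComplexHomologyIso (n : ℕ) :
    (AcyclicResolution.extComplex (triv (Γ := Γ) k) (stdComplex X hX)).homology n ≅
      (forgetAb k).obj (continuousCohomology n X) :=
  (HomologicalComplex.homologyFunctor _ _ n).mapIso (extComplexIso X hX) ≪≫
    ((homogeneousCochains X).sc n).mapHomologyIso (forgetAb k)

/-- **THE COMPARISON THEOREM: `Extⁿ_{C_Γ}(triv k, X) ≃+ Hⁿ_cont(Γ, X)`** — `Ext` in the abelian
category of `k`-linear representations of the COMPACT group `Γ` with open stabilisers (Harari's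
`C_G`), from the trivial representation `k`, versus Mathlib's continuous cohomology (homogeneous
continuous cochains), for `X` topologically discrete with open stabilisers.
[cite: Harari2020, §4.3, Remark 4.24][cite: SerreGaloisCohomology1997, I §2.5] -/
def extTrivAddEquivContinuousCohomology (n : ℕ) :
    Ext (triv (Γ := Γ) k) (stdBase X hX) n ≃+ (continuousCohomology n X : TopModuleCat.{u} k) :=
  (extTrivAddEquivExtComplexHomology X hX n).trans
    (extComplexHomologyIso X hX n).addCommGroupIsoToAddEquiv

end Standard

end DiscreteRep

/-! ## §7 The Galois case: `Extⁿ_{C_{Γ_K}}(ℤ, M) ≃+ Hⁿ(K, M)` -/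

namespace DiscreteRep

open CategoryTheory CategoryTheory.Abelian Literature.NumberTheory.GaloisRepresentations Field

variable {K : Type} [Field K] [CompactSpace (absoluteGaloisGroup K)] {M : Type} [AddCommGroup M]
  [TopologicalSpace M] [DiscreteTopology M]

/-- **`Extⁿ(ℤ, M) ≃+ Hⁿ(K, M)`**: `Ext` in the category `C_{Γ_K}` of discrete representations of the
(compact) absolute Galois group, from the trivial module `ℤ`, is the tree's Galois cohomology
`galoisCohomology ρ n` (continuous cochains) — Harari §4.3 / Remark 4.24 for `G = Γ_K`.
[cite: Harari2020, §4.3, Remark 4.24] -/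
def extTrivAddEquivGaloisCohomology (ρ : DiscreteGaloisModule K M) (n : ℕ) :
    Ext (triv (Γ := absoluteGaloisGroup K) ℤ) (ofDiscreteGaloisModule ρ) n ≃+ galoisCohomology ρ n :=
  extTrivAddEquivContinuousCohomology (k := ℤ) ρ.toTopRep (isDiscrete_of_continuousRep ρ) n

end DiscreteRep

end Literature.Algebra.Homology
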